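import Literature.NumberTheory.Weil1965.AdelicSiegelMeasureFrameHyperplane
import Summits.HodgeConjecture.HodgeConjecture.Theorems.H413E2SWSplitPlaceHNormLocal
import HarnessLib

/-!
# H413 · E-2 · SW2 (iii) — I-CLOSE: the (S-3E) socket `hS3E` at the CM ∕ unitary datum (`h = hNorm`)

Cell `hodgecm-mathlib`, crux H413 (`stmt-HodgeConjecture-24833`), child line `Cruxes/H413/Lines/F0_E2SiegelWeilWeilRange.lean` ED. 8,
stub `stub_SW2iii_siegelWeil`, identity half; F0P4-plan (g5) ORDER OF THE CLOSE 2026-08-31T06:16:45Z ∕ 06:22:41Z.  KERNEL MATHEMATICS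
ONLY (no definition, no `sorry`).  HC_CM is proved only modulo the 7 printed citations until rung 0 closes.

WHAT THIS FILE DOES.  ★ (T5) `E2SWIdentityCloseFibreCMFrame.hfib_CM_of_frame` takes the (S-3E) coordinate-hyperplane nulls of Weil's
Siegel–Eisenstein measure `E_X` as the binder

  `hS3E : ∀ β, (∀ x, (hNorm x)_v = (β x_v).1 ⬝ᵥ (β x_v).2) → (∃ cst > 0, β_* μ_K^{n+n} = cst • μ_K^n ⊗ μ_K^n) →
            E_X {(β x_v).1 = 0} = 0 ∧ E_X {(β x_v).2 = 0} = 0`.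

`hS3E_of_hNorm` IS that binder, for `h` with `hhN : h = hNorm`: the generic null theorem ★ `Literature.NumberTheory.Weil1965.
adelicSiegelMeasure_frameHyperplane_eq_zero` (F0P4-p08 (g4), p812949: test functions `𝟙_{β⁻¹((𝔭^k)^n × (𝔭^j)^n)} ⊗ Ψ`, dominated
convergence of the `ξ`-series of `E_X`, local factors ★ `LocalSplitFormBoxCharacterIntegral`) fed the two CM letters of ★
`E2SWSplitPlaceFrame` (B-p08 (g18), p812985): `hadd := hNorm_single_add_of_mem` (no cross terms across the place splitting) and
`hloc := hNorm_single_eq_adeleSingleHom_dotProduct β hQ` (`hNorm (single a) = ι_v((β a).1 ⬝ᵥ (β a).2)`).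

## References
* [Weil1965] A. Weil, *Sur la formule de Siegel dans la théorie des groupes classiques*, Acta Math. 113 (1965), Chap. IV n° 41 (35)
  p. 59; Chap. V n° 50–51 pp. 73–75.
-/

set_option autoImplicit false
-- the cell's `Summit.HodgeConjecture.HodgeConjecture.…` namespace repeats the summit name by design (D-0017 layout)
set_option linter.dupNamespace false

noncomputable section

open MeasureTheory NumberField IsDedekindDomain
open scoped NNReal ENNReal Matrix
open Literature.NumberTheory.Automorphic Literature.NumberTheory.Automorphic.AdelicVector
open Literature.NumberTheory.Weil1965 Literature.NumberTheory.Weil1965.UnitaryDoubling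
open Literature.NumberTheory.GelbartRogawski1991 Literature.NumberTheory.GelbartRogawski1991.UnitaryDualPair

namespace Summit.HodgeConjecture.HodgeConjecture.Cruxes.H413.E2SWFrameHyperplaneCM

/-- **(S-3E) AT THE CM ∕ UNITARY DATUM — the `hS3E` binder of ★ (T5) `hfib_CM_of_frame`, VERBATIM**: for `h = hNorm` (Weil's invariant `i_X` of
the doubled theta carrier), every finite place `v`, every Haar measure `μ_K` on `F_v` and every split frame `β` at `v` reading `(hNorm x)_v` as the
split form and transporting `μ_K^{n+n}` to a multiple of `μ_K^n ⊗ μ_K^n`, Weil's `E_X` gives measure `0` to both coordinate hyperplanes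
`{(β x_v).1 = 0}`, `{(β x_v).2 = 0}`. [cite: Weil1965, Chap. V n° 51, pp. 73–75] [cite: Weil1965, Chap. IV n° 41, (35) p. 59] -/
theorem hS3E_of_hNorm (F E : Type) [Field F] [NumberField F] [Field E] [NumberField E] [Algebra F E] [Algebra.IsQuadraticExtension F E]
    (c : E ≃ₐ[F] E) {δ : E} (hcδ : c δ = -δ) (hδ : δ ≠ 0) {d : F} (hd : δ * δ = algebraMap F E d)
    (N : ℕ) {n : ℕ} (e : Fin N × Fin 1 ≃ Fin n) (TV : Matrix (Fin N) (Fin N) F) (hVd : IsUnit TV.det)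
    (TW : Matrix (Fin 1) (Fin 1) F) (hWd : IsUnit TW.det)
    [MeasurableSpace (adeleQuotient F)] [BorelSpace (adeleQuotient F)]
    [MeasurableSpace (AdeleRing (𝓞 F) F)] [BorelSpace (AdeleRing (𝓞 F) F)]
    (νX : Measure (Fin (n + n) → AdeleRing (𝓞 F) F)) [νX.IsAddHaarMeasure]
    (h : (Fin (n + n) → AdeleRing (𝓞 F) F) → AdeleRing (𝓞 F) F) (hh : Continuous h)
    (hhN : ∀ x, h x = hNorm F E c hcδ hδ N e TV hVd TW hWd x)
    (hB : ∀ Φ ∈ piSchwartzBruhat F (Fin (n + n)), Summable fun ξ : F => ‖adelicSiegelCoeff F (Fin (n + n)) νX h Φ ξ‖)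
    [Nonempty (Fin n)]
    (v : HeightOneSpectrum (𝓞 F)) [MeasurableSpace (v.adicCompletion F)] [BorelSpace (v.adicCompletion F)]
    (μK : Measure (v.adicCompletion F)) [μK.IsAddHaarMeasure] :
    ∀ β : (Fin (n + n) → v.adicCompletion F) ≃ₗ[v.adicCompletion F]
        ((Fin n → v.adicCompletion F) × (Fin n → v.adicCompletion F)),
      (∀ x : Fin (n + n) → AdeleRing (𝓞 F) F,
        AdelicGroupData.adeleEval F v (hNorm F E c hcδ hδ N e TV hVd TW hWd x) =
          (β (evalAt F (Fin (n + n)) v x)).1 ⬝ᵥ (β (evalAt F (Fin (n + n)) v x)).2) →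
      (∃ cst : ℝ≥0, 0 < cst ∧
        Measure.map β (Measure.pi fun _ : Fin (n + n) => μK) =
          (cst : ℝ≥0∞) • ((Measure.pi fun _ : Fin n => μK).prod (Measure.pi fun _ : Fin n => μK))) →
      adelicSiegelMeasure F (Fin (n + n)) νX h hh hB {x | (β (evalAt F (Fin (n + n)) v x)).1 = 0} = 0 ∧
        adelicSiegelMeasure F (Fin (n + n)) νX h hh hB {x | (β (evalAt F (Fin (n + n)) v x)).2 = 0} = 0 := by
  intro β hQ hHaar
  have hfun : h = hNorm F E c hcδ hδ N e TV hVd TW hWd := funext hhN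
  subst hfun
  exact adelicSiegelMeasure_frameHyperplane_eq_zero F (Fin (n + n)) νX _ hh hB v μK β hHaar
    (fun a y hy => E2SWSplitPlaceFrame.hNorm_single_add_of_mem F E c hcδ hδ hd N e TV hVd TW hWd v a hy)
    (fun a => E2SWSplitPlaceFrame.hNorm_single_eq_adeleSingleHom_dotProduct F E c hcδ hδ hd N e TV hVd TW hWd v β hQ a)

end Summit.HodgeConjecture.HodgeConjecture.Cruxes.H413.E2SWFrameHyperplaneCM

end
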